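import Mathlib.CategoryTheory.SingleObj
import Mathlib.CategoryTheory.Comma.Over.Basic
import Mathlib.Tactic.Group
import Literature.AlgebraicGeometry.Frobenioids.PermutationOfPrimes
import Literature.AlgebraicGeometry.Frobenioids.NonPreservationOfUnits
import Literature.AlgebraicGeometry.Frobenioids.DivSlimExample
import HarnessLib

/-!
# Frobenioids I, §3–§4: `Aut(D_A → D) ≅ G` for the one-object category of a group (proof)

Mochizuki, *The geometry of Frobenioids I: the general theory*, Kyushu J. Math. **62** (2008)
293–400, kurims text pp. 71, 87, 94 [cite: MochizukiFrdI2008, Ex. 3.8 p.71]: "if `A ∈ Ob(D)`, then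
`Aut(D_A → D) ≅ G`" (Ex. 3.8 p. 71), "`End_D(A) = G` [so `Aut(D_A → D) = G`]" (Ex. 4.7 (ii) p. 87),
"`U ⊆ G = Aut(D_A → D)`" (Rem. 4.11.2 p. 94), for `D` the one-object category of a group `G`.

PROVED here in general (`SingleObjAut.autForgetMulEquiv`): the automorphism group of the forgetful functor
`D_A → D`, `D = SingleObj G`, is `G` — an automorphism is the natural family `f ↦ f⁻¹ c f` determined by
its component `c` at `(A, id)`.  This DISCHARGES the named statements `Ex38.AutForgetIsoG`,
`Ex39.AutForgetIsoG`, `Ex47ii.AutForgetIsoG` of `PermutationOfPrimes.lean`, `NonPreservationOfUnits.lean`,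
`DivSlimExample.lean`.
-/

namespace Literature.AlgebraicGeometry.Frobenioids

open CategoryTheory

namespace SingleObjAut

variable (G : Type) [Group G]

/-- The element of `G` underlying an arrow of `SingleObj G`. [cite: MochizukiFrdI2008, Ex. 3.8 p.71] -/
abbrev elt {x y : SingleObj G} (f : x ⟶ y) : G := f

/-- An element `a ∈ G` as an automorphism of an object of `SingleObj G`. [cite: MochizukiFrdI2008, Ex. 3.8 p.71] -/
def isoOf (x : SingleObj G) (a : G) : x ≅ x where
  hom := a
  inv := (a⁻¹ : G)
  hom_inv_id := by rw [SingleObj.comp_as_mul, SingleObj.id_as_one]; exact inv_mul_cancel a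
  inv_hom_id := by rw [SingleObj.comp_as_mul, SingleObj.id_as_one]; exact mul_inv_cancel a

/-- The natural family `f ↦ f⁻¹ · c · f` on the objects `(A, f)` of `D_A`: an automorphism of the
forgetful functor `D_A → D` (naturality: `(f' k)⁻¹ c (f' k) · ? `, FrdI Ex. 3.8 p. 71).
[cite: MochizukiFrdI2008, Ex. 3.8 p.71] -/
def familyOf (c : G) : Aut (Over.forget (SingleObj.star G)) :=
  NatIso.ofComponents (fun o => isoOf G o.left ((elt G o.hom)⁻¹ * c * elt G o.hom)) fun {o o'} k => by
    have hk : elt G o'.hom * elt G k.left = elt G o.hom := by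
      have := Over.w k
      rw [SingleObj.comp_as_mul] at this
      exact this
    show k.left ≫ (((elt G o'.hom)⁻¹ * c * elt G o'.hom : G) : o'.left ⟶ o'.left) =
      (((elt G o.hom)⁻¹ * c * elt G o.hom : G) : o.left ⟶ o.left) ≫ k.left
    rw [SingleObj.comp_as_mul, SingleObj.comp_as_mul, ← hk]
    show (elt G o'.hom)⁻¹ * c * elt G o'.hom * elt G k.left =
      elt G k.left * ((elt G o'.hom * elt G k.left)⁻¹ * c * (elt G o'.hom * elt G k.left))
    group

/-- The component of `familyOf c` at `(A, f)` is `f⁻¹ c f`. [cite: MochizukiFrdI2008, Ex. 3.8 p.71] -/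
theorem familyOf_app (c : G) (o : Over (SingleObj.star G)) :
    elt G ((familyOf G c).hom.app o) = (elt G o.hom)⁻¹ * c * elt G o.hom := rfl

/-- An automorphism of `D_A → D` is determined by its component at `(A, id)`: `α_{(A,f)} = f⁻¹ α_{(A,id)} f`
(naturality along `f : (A, f) → (A, id)`). [cite: MochizukiFrdI2008, Ex. 3.8 p.71] -/
theorem app_eq (α : Aut (Over.forget (SingleObj.star G))) (o : Over (SingleObj.star G)) :
    elt G (α.hom.app o) = (elt G o.hom)⁻¹ * elt G (α.hom.app (Over.mk (𝟙 _))) * elt G o.hom := by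
  let k : o ⟶ Over.mk (𝟙 (SingleObj.star G)) := Over.homMk o.hom (Category.comp_id _)
  have nat := α.hom.naturality k
  -- `nat : o.hom ≫ α_{(A,id)} = α_o ≫ o.hom`
  have nat' : elt G (α.hom.app (Over.mk (𝟙 _))) * elt G o.hom = elt G o.hom * elt G (α.hom.app o) := by
    have := nat
    rw [SingleObj.comp_as_mul, SingleObj.comp_as_mul] at this
    exact this
  rw [mul_assoc, nat', ← mul_assoc, inv_mul_cancel, one_mul]

/-- `Aut(D_A → D) ≅ G` for `D` the one-object category of the group `G` (FrdI Ex. 3.8 p. 71; Ex. 4.7 (ii)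
p. 87; Rem. 4.11.2 p. 94): `α ↦ α_{(A, id)}` with inverse `c ↦ (f ↦ f⁻¹ c f)` (PROVED).
[cite: MochizukiFrdI2008, Ex. 3.8 p.71] -/
noncomputable def autForgetMulEquiv : Aut (Over.forget (SingleObj.star G)) ≃* G where
  toFun α := elt G (α.hom.app (Over.mk (𝟙 _)))
  invFun c := familyOf G c
  left_inv α := by
    refine Iso.ext (NatTrans.ext (funext fun o => ?_))
    show (((elt G o.hom)⁻¹ * elt G (α.hom.app (Over.mk (𝟙 _))) * elt G o.hom : G) : o.left ⟶ o.left) =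
      α.hom.app o
    rw [← app_eq]
  right_inv c := by
    show (elt G (𝟙 (SingleObj.star G)))⁻¹ * c * elt G (𝟙 (SingleObj.star G)) = c
    rw [SingleObj.id_as_one]
    show (1 : G)⁻¹ * c * 1 = c
    group
  map_mul' α β := by
    show elt G ((β ≪≫ α).hom.app (Over.mk (𝟙 _))) = elt G (α.hom.app _) * elt G (β.hom.app _)
    show elt G (β.hom.app (Over.mk (𝟙 _)) ≫ α.hom.app (Over.mk (𝟙 _))) = _
    rw [SingleObj.comp_as_mul]

end SingleObjAut

/-- **Example 3.8**: "`Aut(D_A → D) ≅ G`" (FrdI p. 71; DISCHARGED). [cite: MochizukiFrdI2008, Ex. 3.8 p.71] -/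
theorem Ex38.autForgetIsoG_holds : Ex38.AutForgetIsoG :=
  ⟨SingleObjAut.autForgetMulEquiv RatSemidirect.G⟩

/-- **Example 3.9 / Remark 4.11.2**: "`G = Aut(D_A → D)`" (FrdI pp. 71, 94; DISCHARGED).
[cite: MochizukiFrdI2008, Rem. 4.11.2 p.94] -/
theorem Ex39.autForgetIsoG_holds : Ex39.AutForgetIsoG :=
  ⟨SingleObjAut.autForgetMulEquiv RatSemidirect.G⟩

/-- **Example 4.7 (ii)**: "`End_D(A) = G` [so `Aut(D_A → D) = G`]" (FrdI p. 87; DISCHARGED).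
[cite: MochizukiFrdI2008, Ex. 4.7 (ii) p.87] -/
theorem Ex47ii.autForgetIsoG_holds : Ex47ii.AutForgetIsoG :=
  ⟨SingleObjAut.autForgetMulEquiv Ex47ii.G⟩

end Literature.AlgebraicGeometry.Frobenioids
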